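import Mathlib
import Summits.ResolutionOfSingularities.ResolutionOfSingularities.Theorems.WildQuotientsWildQuotientResolutionStubQuotientModelNormal
import Summits.ResolutionOfSingularities.ResolutionOfSingularities.Theorems.WildQuotientsWildQuotientResolutionQuotientIso
import Summits.ResolutionOfSingularities.ResolutionOfSingularities.Theorems.WildQuotientsGaloisQuotientEtaleGlued
import Literature.AlgebraicGeometry.Resolution.ProjectiveSpaceRegular
import Literature.AlgebraicGeometry.Resolution.CompletedPullbackRegular

/-!
# Cyclic divisorial transfer — the geometric glue (crux stmt-ResolutionOfSingularities-15640, line `Sketch`, lead c8)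

Chart lemmas turning the local algebra (`CyclicTransferAlgebra`) into a statement about the glued quotient
`V/G` (`Literature.AlgebraicGeometry.RelativeSpec.ActionOver.glued`):
* `stub_isRegular_glued` — `V/G` is regular as soon as every chart ring `Γ(O, r⁻¹U)^G` is a regular ring;
* `stub_augIdeal_localization_of_stalk` — the stalk form of the divisorial hypothesis (augmentation ideal of
  the stalk action principal) gives the localised form for the ring of sections of an affine chart;
* `stub_stalkAug_restrict` — the stalk form descends to a `G`-stable open subscheme;
* `stub_fixedPoint_of_comap_act` — a prime of the chart ring fixed by `act g` is the prime of a `g`-fixed point.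
-/

set_option linter.dupNamespace false

noncomputable section

open CategoryTheory Limits AlgebraicGeometry TopologicalSpace IsLocalRing
open Literature.AlgebraicGeometry.Resolution Literature.AlgebraicGeometry.RelativeSpec

namespace Summit.ResolutionOfSingularities.ResolutionOfSingularities.Theorems.WildQuotientResolution.CyclicTransfer

/-- STUB `stub_isRegular_glued` (S–M, classical): **the glued quotient is regular when its chart rings are.**
For an action `ρ` of a finite group `G` on `X` over a separated base `Y` (`r : X → Y` separated), if every ring of invariants `Γ(O, (O ↪ X → Y)⁻¹U)^G` (`O` a stable open
affine over `Y`, `U ⊆ Y` affine open) is a regular ring, then `X/G = ρ.glued` is a regular scheme: every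
point lies in a chart `Spec Γ(O, r⁻¹U)^G ↪ O/G ↪ X/G` (open immersions `invariants.openCover.f U`, `gluedι O`;
`gluedι_jointly_surjective`, `SubringDatum.fromSpec_preimage`; cf. `QuotientModelNormal.isIntegrallyClosed_stalk_glued_of_stalk`) and `Spec` of a regular ring is regular
(`Scheme.isRegular_Spec`, `Scheme.IsRegular.of_forall_exists_isOpenImmersion`). [folklore; SGA1 Exp. V §1] -/
theorem stub_isRegular_glued {X Y : Scheme.{0}} {r : X ⟶ Y} {G : Type} [Group G] [Finite G]
    (ρ : ActionOver r G) [Y.IsSeparated] [IsSeparated r]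
    (h : ∀ (O : ρ.StableAffineOpens) (U : Y.affineOpens),
      IsRegularRing ((ρ.restrict O.1 O.2.1).invariants.ring U.1)) :
    Scheme.IsRegular ρ.glued := by
  sorry

/-- STUB `stub_augIdeal_localization_of_stalk` (M, classical): **stalk form ⟹ chart form of the divisorial
hypothesis.** For an action `ρ` over `r : X → Y`, an open `U ⊆ Y` with `r⁻¹U` affine, `g ∈ G` and a point
`x ∈ r⁻¹U` fixed by `g⁻¹`: if the augmentation ideal of the STALK automorphism
`a = stalkSpecializes ≫ (g⁻¹).stalkMap x` of `𝒪_{X,x}` is principal, then the extension to the local ring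
`Γ(X, r⁻¹U)_𝔮` (`𝔮` the prime of `x`) of the augmentation ideal `(act g b - b : b)` of the action on sections
(`ActionOver.act g U = (g⁻¹)♯`) is principal. (Under `Γ(X, r⁻¹U)_𝔮 ≅ 𝒪_{X,x}` (`IsAffineOpen.isLocalization_stalk`)
the germ of `act g b` is `a (germ b)` (`Scheme.Hom.germ_stalkMap`), so the extended ideal is the augmentation
ideal of `a`: every germ is `b/t`, and `a(b/t) - b/t = ((a b - b) t - b (a t - t)) / (t · a t)`.) [folklore] -/
theorem stub_augIdeal_localization_of_stalk {X Y : Scheme.{0}} {r : X ⟶ Y} {G : Type} [Group G]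
    (ρ : ActionOver r G) (U : Y.Opens) (hU : IsAffineOpen (r ⁻¹ᵁ U)) (g : G)
    (x : X) (hxU : x ∈ r ⁻¹ᵁ U) (hgx : (ρ.aut g⁻¹).hom.base x = x)
    (hdiv : (Ideal.span (Set.range fun s : X.presheaf.stalk x =>
        (X.presheaf.stalkSpecializes (specializes_of_eq hgx) ≫ (ρ.aut g⁻¹).hom.stalkMap x).hom s -
          s)).IsPrincipal) :
    ((Ideal.span (Set.range fun b : Γ(X, r ⁻¹ᵁ U) => ρ.act g U b - b)).map
      (algebraMap Γ(X, r ⁻¹ᵁ U)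
        (Localization.AtPrime (hU.primeIdealOf ⟨x, hxU⟩).asIdeal))).IsPrincipal := by
  sorry

/-- STUB `stub_stalkAug_restrict` (S–M, classical): **the stalk form of the divisorial hypothesis descends to a
`G`-stable open subscheme.** For a `G`-stable open `O ⊆ X`, a point `x ∈ O` fixed by `g`, and the restricted
action `ρ.restrict O hO` (whose automorphisms are the restrictions `restrictHom`, `restrictHom_ι`): the stalk
isomorphism `𝒪_{O,x} ≅ 𝒪_{X,x}` (`O.ι.stalkMap`) intertwines the two stalk actions of `g`, so principality of
the augmentation ideal transfers. [folklore] -/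
theorem stub_stalkAug_restrict {X Y : Scheme.{0}} {r : X ⟶ Y} {G : Type} [Group G]
    (ρ : ActionOver r G) (O : X.Opens) (hO : ∀ g : G, (ρ.aut g).hom ⁻¹ᵁ O = O) (g : G)
    (x : O) (hgx : (ρ.aut g).hom.base x.1 = x.1)
    (hdiv : (Ideal.span (Set.range fun s : X.presheaf.stalk x.1 =>
        (X.presheaf.stalkSpecializes (specializes_of_eq hgx) ≫ (ρ.aut g).hom.stalkMap x.1).hom s -
          s)).IsPrincipal) :
    ∃ hgx' : ((ρ.restrict O hO).aut g).hom.base x = x,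
      (Ideal.span (Set.range fun s : (O : Scheme.{0}).presheaf.stalk x =>
        ((O : Scheme.{0}).presheaf.stalkSpecializes (specializes_of_eq hgx') ≫
          ((ρ.restrict O hO).aut g).hom.stalkMap x).hom s - s)).IsPrincipal := by
  sorry

/-- STUB `stub_fixedPoint_of_comap_act` (S–M, classical): **a prime of the chart ring fixed by `act g` is the
prime of a point fixed by `g⁻¹`.** For `U ⊆ Y` with `r⁻¹U` affine and a prime `𝔮 ⊆ Γ(X, r⁻¹U)` with
`(act g)⁻¹ 𝔮 = 𝔮`, the point `x ∈ r⁻¹U` with `𝔮 = 𝔮_x` (`IsAffineOpen.fromSpec`, `primeIdealOf`) satisfies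
`g⁻¹ x = x`: on the affine chart `Spec (act g U) = isoSpec⁻¹ ≫ (g⁻¹)|_{r⁻¹U} ≫ isoSpec`
(`ActionOver.specMap_act`) and `Spec` of a ring map acts on points by `comap`. [folklore] -/
theorem stub_fixedPoint_of_comap_act {X Y : Scheme.{0}} {r : X ⟶ Y} {G : Type} [Group G]
    (ρ : ActionOver r G) (U : Y.Opens) (hU : IsAffineOpen (r ⁻¹ᵁ U)) (g : G)
    (𝔮 : Ideal Γ(X, r ⁻¹ᵁ U)) [𝔮.IsPrime] (h𝔮 : 𝔮.comap (ρ.act g U) = 𝔮) :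
    ∃ (x : X) (hxU : x ∈ r ⁻¹ᵁ U), (hU.primeIdealOf ⟨x, hxU⟩).asIdeal = 𝔮 ∧
      (ρ.aut g⁻¹).hom.base x = x := by
  sorry

/-! ## The transfer (lead) -/

/-- **Cyclic divisorial transfer** (the route's `CyclicDivisorialModel ⟹ crux` step for `|G| = p`, K–L being
proved): for the crux data `(X′, X₁, q, G, ρ)` with `ρ` faithful, `|G| = p` and `dim X₁ > 0`, a
`G`-equivariant proper birational REGULAR integral model `π : V → X′` with a `G`-stable affine cover on which,
at every `G`-fixed point `v`, the augmentation ideal `(g♯ s - s : s ∈ 𝒪_{V,v})` of the stalk action of every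
`g` is principal (the Király–Lütkebohmert terminal state), gives a resolution of `X₁`: the quotient
`Y₁ = V/G → X₁` (`QuotientModelNormal`) is proper birational, and `Y₁` is REGULAR — at the image of a fixed
point by Király–Lütkebohmert Thm 2 (`Theorems.kl_isRegularLocalRing_eqLocus`, `(B^σ)_𝔭 = (B_𝔮)^σ`), at the
image of a free point because `V → V/G` is flat there (Chase–Harrison–Rosenberg) and regularity descends
along flat local maps. [cite: KiralyLutkebohmert2013, Thm 2] [cite: SGA1, Exp. V, Prop. 2.2] -/
theorem cyclicDivisorialTransfer (p : ℕ) (hp : p.Prime) (k : Type) [Field k] [CharP k p]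
    (X' X₁ : Scheme.{0}) (f : X₁ ⟶ Spec (.of k)) (q : X' ⟶ X₁) (G : Type) [Group G] [Finite G]
    (ρ : G →* Aut X') (hcard : Nat.card G = p) (hfaith : Function.Injective ρ)
    [IsSeparated f] [LocallyOfFiniteType f] [QuasiCompact f] [IsIntegral X₁] [IsIntegral X']
    [IsFinite q] (hdim : ¬ topologicalKrullDim X₁ ≤ 0) (hsurj : Function.Surjective q.base)
    (hU : ∃ U : X₁.Opens, Dense (U : Set X₁) ∧ Etale (q ∣_ U))
    (hρ : ∀ g : G, (ρ g).hom ≫ q = q)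
    (horb : ∀ x y : X', q.base x = q.base y → ∃ g : G, (ρ g).hom.base x = y)
    (V : Scheme.{0}) (π : V ⟶ X') (ρV : G →* Aut V) [IsProper π] (hbir : IsBirational π)
    [IsIntegral V] (hVreg : Scheme.IsRegular V)
    (hequiv : ∀ g : G, (ρV g).hom ≫ π = π ≫ (ρ g).hom)
    (hcov : ∀ v : V, ∃ W : V.Opens, IsAffineOpen W ∧ v ∈ W ∧ ∀ g : G, (ρV g).hom ⁻¹ᵁ W = W)
    (hdiv : ∀ (g : G) (v : V) (hv : (ρV g).hom.base v = v),
      (Ideal.span (Set.range fun s : V.presheaf.stalk v =>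
        (V.presheaf.stalkSpecializes (specializes_of_eq hv) ≫ (ρV g).hom.stalkMap v).hom s -
          s)).IsPrincipal) :
    Scheme.HasResolution X₁ := by
  sorry

end Summit.ResolutionOfSingularities.ResolutionOfSingularities.Theorems.WildQuotientResolution.CyclicTransfer

end
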